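/-
Copyright (c) 2026. Released under the Apache 2.0 license.
-/
import Literature.NumberTheory.EllipticCurves.ManinConstantSemistableTwistSharpProofs
import Literature.NumberTheory.EllipticCurves.NodalCubicFormalGroupProofs
import Literature.NumberTheory.EllipticCurves.KrausNonMinimalityTwoThreeProofs
import HarnessLib

/-!
# The Manin-constant integrality `‖q‖_p ≤ 1` at potentially multiplicative additive primes

[Proofs] This file continues the programme recorded in the docstring of the fact
`Literature.NumberTheory.EllipticCurves.edixhoven_int_of_neronLattice_eq_smul_periodLattice`
(`NeronIsogenyScaling.lean`): the local integrality `‖q‖_p ≤ 1` of the Néron–period scaling `q`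
is known at every prime of good or multiplicative reduction
(`ManinConstantFiniteHeightPrimesProofs`) and, at an ADDITIVE prime, is reduced by the
Newton-polygon ender `…_of_semistableTwist_sharp` (`ManinConstantSemistableTwistSharpProofs`) to
exhibiting, over a finite extension `K/ℚ_p` with ring of integers `O` and uniformiser `π`
(`‖π‖ᵉ = p⁻¹`), an `O`-model `V''` of a twist `V'' ⊗ K = (πᵏ, r, s, t) • (W' ⊗ K)` together
with a UNIT coefficient of `[p]_{V''}` in some degree `J` with `(J − 1)k < Je`.

Here we discharge this for the **potentially multiplicative** additive primes, i.e. those with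
`‖j(W')‖_p > 1` (Kodaira types `Iₙ*`, `n ≥ 1`, at odd `p`; the quadratic twists of Tate curves
at `p = 2`), at EVERY prime `p`:

* `coeff_formalMul_prime_nodalCubicOfSlopes` — over any field of characteristic `p` the
  multiplication-by-`p` series of the nodal cubic `T(α, β)` (`NodalCubicFormalGroupProofs`),
  `α ≠ β`, has vanishing coefficients in degrees `0 < n < p` and coefficient `(α − β)^{p−1}` in
  degree `p` (from `Φ([p]z) = Φ(z)ᵖ = Φ^{(p)}(zᵖ)`); with the order lemma
  `coeff_subst_eq_mul_of_forall_coeff_lt_eq_zero`.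
* `norm_rst_le_one_of_variableChange_eq` — Silverman VII.1.3(d) over any ultrametric normed
  field: between integral models, a change of variables with `‖u‖ ≤ 1` has `‖r‖, ‖s‖, ‖t‖ ≤ 1`.
* `exists_variableChange_of_c₄_eq_of_c₆_eq'` — curves with proportional invariants
  `c₄' = w⁻⁴c₄`, `c₆' = w⁻⁶c₆` are isomorphic, over any field of characteristic zero (the tree's
  `exists_variableChange_of_c₄_eq_of_c₆_eq` is the case `ℚ`).
* `exists_nodalTwist_of_one_lt_norm_j` — THE NODAL TWIST: for `W'/ℚ` globally minimal with
  `‖j‖_p > 1` and `‖c₄‖_p = p⁻ⁿ`, over `K = ℚ_p(√(−c₄/c₆))` the curve `W'` is isomorphic to the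
  `p`-integral model `E_j = (1, 0, 0, −36/(j − 1728), −1/(j − 1728))` of invariant `j`, whose
  reduction `y² + xy = x³` is a split node; rescaling by the unit part `w` of `u(D) = wπᵏ`
  gives an `O`-curve `V''` with `V'' ⊗ K = (πᵏ, r, s, t) • (W' ⊗ K)`, `4k = ne`, reduction the
  nodal cubic `T(−w̄, 0)` and hence a unit coefficient of `[p]_{V''}` in degree exactly `p`.
* `padicNorm_le_one_of_neronLattice_eq_smul_periodLattice_of_one_lt_norm_j` — consequently
  `‖q‖_p ≤ 1` whenever `(p − 1)·v_p(c₄) < 4p`; and the hypothesis-free corollaries at `p = 2`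
  (`…_two`: `v₂(c₄) < 8`) and `p = 3` (`…_three`: `v₃(c₄) ≤ 5`), where the bound follows from
  `v_p(Δ_min) > 3v_p(c₄)` (`norm_minimalDiscriminantInt_lt_of_one_lt_norm_j`) and the Kraus
  non-minimality bounds of `KrausNonMinimalityTwoThreeProofs`.

What remains of the fact's local programme after this file are the potentially GOOD additive
types at `p = 2, 3` (see the fact's docstring).

## References
* [EdixhovenManin1991] B. Edixhoven, *On the Manin constants of modular elliptic curves*,
  in: Arithmetic algebraic geometry (Texel, 1989), Progr. Math. 89 (1991), 25–39, Prop. 2.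
* [SilvermanAEC2009] J. H. Silverman, *The Arithmetic of Elliptic Curves*, 2nd ed., GTM 106,
  Springer 2009: Prop. III.1.4(c) and Table 3.1 (isomorphic iff proportional invariants),
  Prop. IV.2.3 / III.2.5 (`[p]` on a formal group), Prop. VII.1.3(d) (integrality of `r, s, t`),
  Prop. VII.5.5 (potentially multiplicative ⟺ `v(j) < 0`), Ex. 7.1 (Kraus).
* [Kraus1989] A. Kraus, *Quelques remarques à propos des invariants `c₄`, `c₆` et `Δ` d'une
  courbe elliptique*, Acta Arith. 54 (1989), 75–80.
-/

noncomputable section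

open scoped Classical

/-! ### The coefficient of `zᵖ` in `[p]` of a nodal cubic -/

namespace Literature.NumberTheory.EllipticCurves

open PowerSeries
open _root_.WeierstrassCurve

section SubstOrder

variable {R : Type*} [CommRing R]

/-- **Coefficients of a composite below the order.** If `g` has no terms of degree `< n` (`n ≥ 1`)
then `[Xⁿ] f(g) = [X¹]f · [Xⁿ]g`. [folklore] -/
theorem coeff_subst_eq_mul_of_forall_coeff_lt_eq_zero (f : R⟦X⟧) {g : R⟦X⟧} {n : ℕ} (hn : 1 ≤ n)
    (hg : ∀ m < n, coeff m g = 0) : coeff n (f.subst g) = coeff 1 f * coeff n g := by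
  have hg0 : constantCoeff g = 0 := by rw [← coeff_zero_eq_constantCoeff_apply]; exact hg 0 hn
  obtain ⟨h, hh⟩ := (X_pow_dvd_iff (n := n)).mpr hg
  rw [coeff_subst' (HasSubst.of_constantCoeff_zero' hg0), finsum_eq_single _ 1]
  · rw [pow_one, smul_eq_mul]
  · intro d hd
    rcases Nat.lt_or_gt_of_ne hd with hd0 | hd2
    · have : d = 0 := by omega
      rw [this, pow_zero, coeff_one, if_neg (by omega), smul_zero]
    · rw [hh, mul_pow, ← pow_mul, coeff_X_pow_mul', if_neg (by nlinarith), smul_zero]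

end SubstOrder

section NodalCoeff

variable {k : Type*} [Field k] {p : ℕ} [hp : Fact p.Prime] [CharP k p] (α β : k)

/-- **`[zⁿ][p]˜ = 0` for `0 < n < p` and `[zᵖ][p]˜ = (α − β)^{p−1}` on the nodal cubic `T(α, β)`,
`α ≠ β`, over any field of characteristic `p`** (split or not): from `Φ([p]z) = Φ(z)ᵖ =
Φ_{αᵖ,βᵖ}(zᵖ)` (`nodalPhi_subst_formalMul`, `nodalPhi_pow_prime`), comparing coefficients
degree by degree (`Φ = 1 + (α − β)z + ⋯`). In particular the formal group of a nodal cubic has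
height `1` with unit coefficient in degree EXACTLY `p`. [cite: SilvermanAEC2009, Prop. III.2.5] -/
theorem coeff_formalMul_prime_nodalCubicOfSlopes (hαβ : α ≠ β) :
    (∀ n, 0 < n → n < p → coeff n ((nodalCubicOfSlopes α β).formalMul p) = 0) ∧
      coeff p ((nodalCubicOfSlopes α β).formalMul p) = (α - β) ^ (p - 1) := by
  have hp0 : p ≠ 0 := hp.out.ne_zero
  have hp1 : 1 < p := hp.out.one_lt
  set P : k⟦X⟧ := (nodalCubicOfSlopes α β).formalMul p with hP
  have hP0 : constantCoeff P = 0 := (nodalCubicOfSlopes α β).constantCoeff_formalMul p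
  have hPs : HasSubst P := HasSubst.of_constantCoeff_zero' hP0
  have hXs : HasSubst ((X : k⟦X⟧) ^ p) := HasSubst.X_pow hp0
  -- `Ψ(P) = Ψ'(Xᵖ)` with `Ψ = Φ − 1`, `Ψ' = Φ^{(p)} − 1`
  set Ψ : k⟦X⟧ := nodalPhi α β - 1 with hΨ
  set Ψ' : k⟦X⟧ := nodalPhi (α ^ p) (β ^ p) - 1 with hΨ'
  have hkey : Ψ.subst P = Ψ'.subst ((X : k⟦X⟧) ^ p) := by
    rw [hΨ, hΨ', ← coe_substAlgHom hPs, ← coe_substAlgHom hXs, map_sub, map_sub, map_one, map_one,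
      coe_substAlgHom, coe_substAlgHom, nodalPhi_subst_formalMul, nodalPhi_pow_prime]
  have hΨ1 : coeff 1 Ψ = α - β := by
    rw [hΨ, map_sub, coeff_one_nodalPhi, coeff_one, if_neg one_ne_zero, sub_zero]
  have hΨ'1 : coeff 1 Ψ' = α ^ p - β ^ p := by
    rw [hΨ', map_sub, coeff_one_nodalPhi, coeff_one, if_neg one_ne_zero, sub_zero]
  have hRHS : ∀ n, coeff n (Ψ'.subst ((X : k⟦X⟧) ^ p)) = if p ∣ n then coeff (n / p) Ψ' else 0 := by
    intro n
    rw [coeff_subst_X_pow hp0]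
    rfl
  -- strong induction: the coefficients of `P` below `p` vanish
  have hlow : ∀ n, 0 < n → n < p → coeff n P = 0 := by
    intro n
    induction n using Nat.strong_induction_on with
    | _ n ih =>
      intro hn hnp
      have h := congrArg (coeff n) hkey
      rw [coeff_subst_eq_mul_of_forall_coeff_lt_eq_zero Ψ hn (fun m hm ↦ ?_), hΨ1, hRHS,
        if_neg (fun hdvd ↦ absurd (Nat.le_of_dvd hn hdvd) (not_le.mpr hnp))] at h
      · exact (mul_eq_zero.mp h).resolve_left (sub_ne_zero.mpr hαβ)
      · rcases Nat.eq_zero_or_pos m with rfl | hm0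
        · rw [coeff_zero_eq_constantCoeff_apply, hP0]
        · exact ih m hm hm0 (hm.trans hnp)
  refine ⟨hlow, ?_⟩
  have h := congrArg (coeff p) hkey
  rw [coeff_subst_eq_mul_of_forall_coeff_lt_eq_zero Ψ hp.out.pos (fun m hm ↦ ?_), hΨ1, hRHS,
    if_pos dvd_rfl, Nat.div_self hp.out.pos, hΨ'1, ← sub_pow_char, ← Nat.sub_add_cancel hp.out.pos,
    pow_succ, Nat.sub_add_cancel hp.out.pos] at h
  · exact mul_left_cancel₀ (sub_ne_zero.mpr hαβ) (by rw [h, mul_comm])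
  · rcases Nat.eq_zero_or_pos m with rfl | hm0
    · rw [coeff_zero_eq_constantCoeff_apply, hP0]
    · exact hlow m hm0 hm

end NodalCoeff

/-! ### Integrality of `r, s, t` between integral models (Silverman VII.1.3(d)) -/

section Integrality

variable {F : Type*} [NormedField F] [IsUltrametricDist F]

/-- `‖a‖, ‖b‖ ≤ 1 ⇒ ‖a + b‖ ≤ 1`. [folklore] -/
private theorem norm_add_le_one {a b : F} (ha : ‖a‖ ≤ 1) (hb : ‖b‖ ≤ 1) : ‖a + b‖ ≤ 1 :=
  (IsUltrametricDist.norm_add_le_max a b).trans (max_le ha hb)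

/-- `‖a‖, ‖b‖ ≤ 1 ⇒ ‖a − b‖ ≤ 1`. [folklore] -/
private theorem norm_sub_le_one {a b : F} (ha : ‖a‖ ≤ 1) (hb : ‖b‖ ≤ 1) : ‖a - b‖ ≤ 1 := by
  rw [sub_eq_add_neg]; exact norm_add_le_one ha (by rwa [norm_neg])

-- `‖a − b‖ ≤ max ‖a‖ ‖b‖` is `norm_sub_le_max_of_isUltrametricDist` (`SelmerInertiaProofs.lean`);
-- the private restatement `norm_sub_le_max'` was removed (dedup-02766).

omit [IsUltrametricDist F] in
/-- `‖a‖, ‖b‖ ≤ 1 ⇒ ‖ab‖ ≤ 1`. [folklore] -/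
private theorem norm_mul_le_one {a b : F} (ha : ‖a‖ ≤ 1) (hb : ‖b‖ ≤ 1) : ‖a * b‖ ≤ 1 := by
  rw [norm_mul]; exact mul_le_one₀ ha (norm_nonneg _) hb

/-- **Between integral Weierstrass models a change of variables with integral `u` has integral
`r, s, t`** (Silverman VII.1.3(d)), over any ultrametric normed field, "integral" meaning norm
`≤ 1`: if `‖r‖ > 1` the relations `u⁶b₆' = b₆ + 2rb₄ + r²b₂ + 4r³` and
`u⁸b₈' = b₈ + 3rb₆ + 3r²b₄ + r³b₂ + 3r⁴` give `‖4r‖, ‖3r‖ ≤ 1`, so `‖r‖ = ‖4r − 3r‖ ≤ 1`; then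
`s² = a₂ − sa₁ + 3r − u²a₂'` and `t² = a₆ + ra₄ + r²a₂ + r³ − ta₃ − rta₁ − u⁶a₆'` bound `s, t`.
[cite: SilvermanAEC2009, Prop. VII.1.3(d)] -/
theorem norm_rst_le_one_of_variableChange_eq {W₁ W₂ : WeierstrassCurve F} {C : VariableChange F}
    (hC : C • W₁ = W₂) (hu : ‖(C.u : F)‖ ≤ 1)
    (h₁ : ‖W₁.a₁‖ ≤ 1 ∧ ‖W₁.a₂‖ ≤ 1 ∧ ‖W₁.a₃‖ ≤ 1 ∧ ‖W₁.a₄‖ ≤ 1 ∧ ‖W₁.a₆‖ ≤ 1)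
    (h₂ : ‖W₂.a₁‖ ≤ 1 ∧ ‖W₂.a₂‖ ≤ 1 ∧ ‖W₂.a₃‖ ≤ 1 ∧ ‖W₂.a₄‖ ≤ 1 ∧ ‖W₂.a₆‖ ≤ 1) :
    ‖C.r‖ ≤ 1 ∧ ‖C.s‖ ≤ 1 ∧ ‖C.t‖ ≤ 1 := by
  obtain ⟨h₁₁, h₁₂, h₁₃, h₁₄, h₁₆⟩ := h₁
  obtain ⟨h₂₁, h₂₂, h₂₃, h₂₄, h₂₆⟩ := h₂
  have h2F : ‖(2 : F)‖ ≤ 1 := by simpa using IsUltrametricDist.norm_natCast_le_one F 2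
  have h3F : ‖(3 : F)‖ ≤ 1 := by simpa using IsUltrametricDist.norm_natCast_le_one F 3
  have h4F : ‖(4 : F)‖ ≤ 1 := by simpa using IsUltrametricDist.norm_natCast_le_one F 4
  -- the `b`'s are integral
  have hb₂ : ‖W₁.b₂‖ ≤ 1 := by
    rw [WeierstrassCurve.b₂]
    exact norm_add_le_one (by rw [sq]; exact norm_mul_le_one h₁₁ h₁₁) (norm_mul_le_one h4F h₁₂)
  have hb₄ : ‖W₁.b₄‖ ≤ 1 := by
    rw [WeierstrassCurve.b₄]
    exact norm_add_le_one (norm_mul_le_one h2F h₁₄) (norm_mul_le_one h₁₁ h₁₃)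
  have hb₆ : ‖W₁.b₆‖ ≤ 1 := by
    rw [WeierstrassCurve.b₆]
    exact norm_add_le_one (by rw [sq]; exact norm_mul_le_one h₁₃ h₁₃) (norm_mul_le_one h4F h₁₆)
  have hb₈ : ‖W₁.b₈‖ ≤ 1 := by
    rw [WeierstrassCurve.b₈]
    refine norm_sub_le_one (norm_add_le_one (norm_sub_le_one (norm_add_le_one ?_ ?_) ?_) ?_) ?_
    · rw [sq]; exact norm_mul_le_one (norm_mul_le_one h₁₁ h₁₁) h₁₆
    · exact norm_mul_le_one (norm_mul_le_one h4F h₁₂) h₁₆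
    · exact norm_mul_le_one (norm_mul_le_one h₁₁ h₁₃) h₁₄
    · rw [sq]; exact norm_mul_le_one h₁₂ (norm_mul_le_one h₁₃ h₁₃)
    · rw [sq]; exact norm_mul_le_one h₁₄ h₁₄
  have hb₆' : ‖W₂.b₆‖ ≤ 1 := by
    rw [WeierstrassCurve.b₆]
    exact norm_add_le_one (by rw [sq]; exact norm_mul_le_one h₂₃ h₂₃) (norm_mul_le_one h4F h₂₆)
  have hb₈' : ‖W₂.b₈‖ ≤ 1 := by
    rw [WeierstrassCurve.b₈]
    refine norm_sub_le_one (norm_add_le_one (norm_sub_le_one (norm_add_le_one ?_ ?_) ?_) ?_) ?_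
    · rw [sq]; exact norm_mul_le_one (norm_mul_le_one h₂₁ h₂₁) h₂₆
    · exact norm_mul_le_one (norm_mul_le_one h4F h₂₂) h₂₆
    · exact norm_mul_le_one (norm_mul_le_one h₂₁ h₂₃) h₂₄
    · rw [sq]; exact norm_mul_le_one h₂₂ (norm_mul_le_one h₂₃ h₂₃)
    · rw [sq]; exact norm_mul_le_one h₂₄ h₂₄
  set u : F := (C.u : F) with hu'
  set r := C.r with hr'
  set s := C.s with hs'
  set t := C.t with ht'
  have hupow : ∀ n : ℕ, ‖u ^ n‖ ≤ 1 := fun n ↦ by rw [norm_pow]; exact pow_le_one₀ (norm_nonneg _) hu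
  have hu6 : ‖u ^ 6 * W₂.b₆‖ ≤ 1 := norm_mul_le_one (hupow 6) hb₆'
  have hu8 : ‖u ^ 8 * W₂.b₈‖ ≤ 1 := norm_mul_le_one (hupow 8) hb₈'
  -- the relations `u⁶ b₆' = …`, `u⁸ b₈' = …`
  have hinv : ∀ n : ℕ, u ^ n * ((C.u⁻¹ : Fˣ) : F) ^ n = 1 := fun n ↦ by
    rw [← mul_pow, hu', Units.mul_inv, one_pow]
  have e₆ : (4 : F) * r ^ 3 = u ^ 6 * W₂.b₆ - W₁.b₆ - 2 * r * W₁.b₄ - r ^ 2 * W₁.b₂ := by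
    have h := WeierstrassCurve.variableChange_b₆ W₁ C
    rw [hC] at h
    linear_combination -(u ^ 6 * h) - (W₁.b₆ + 2 * r * W₁.b₄ + r ^ 2 * W₁.b₂ + 4 * r ^ 3) * hinv 6
  have e₈ : (3 : F) * r ^ 4 =
      u ^ 8 * W₂.b₈ - W₁.b₈ - 3 * r * W₁.b₆ - 3 * r ^ 2 * W₁.b₄ - r ^ 3 * W₁.b₂ := by
    have h := WeierstrassCurve.variableChange_b₈ W₁ C
    rw [hC] at h
    linear_combination -(u ^ 8 * h) -
      (W₁.b₈ + 3 * r * W₁.b₆ + 3 * r ^ 2 * W₁.b₄ + r ^ 3 * W₁.b₂ + 3 * r ^ 4) * hinv 8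
  have hr : ‖r‖ ≤ 1 := by
    by_contra hcon
    rw [not_le] at hcon
    have hrpos : 0 < ‖r‖ := one_pos.trans hcon
    have hr1 : 1 ≤ ‖r‖ := hcon.le
    have hr2 : 1 ≤ ‖r‖ ^ 2 := one_le_pow₀ hr1
    have hr3 : 1 ≤ ‖r‖ ^ 3 := one_le_pow₀ hr1
    -- `‖4r³‖ ≤ ‖r‖²`, `‖3r⁴‖ ≤ ‖r‖³`
    have key₄ : ‖(4 : F) * r ^ 3‖ ≤ ‖r‖ ^ 2 := by
      rw [e₆]
      refine (norm_sub_le_max_of_isUltrametricDist _ _).trans (max_le ?_ ?_)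
      · refine (norm_sub_le_max_of_isUltrametricDist _ _).trans (max_le ?_ ?_)
        · exact (norm_sub_le_max_of_isUltrametricDist _ _).trans
            (max_le (hu6.trans hr2) (hb₆.trans hr2))
        · rw [norm_mul, norm_mul]
          calc ‖(2 : F)‖ * ‖r‖ * ‖W₁.b₄‖ ≤ 1 * ‖r‖ * 1 := by gcongr
            _ = ‖r‖ ^ 1 := by ring
            _ ≤ ‖r‖ ^ 2 := pow_le_pow_right₀ hr1 (by norm_num)
      · rw [norm_mul, norm_pow]
        exact mul_le_of_le_one_right (pow_nonneg (norm_nonneg _) _) hb₂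
    have key₃ : ‖(3 : F) * r ^ 4‖ ≤ ‖r‖ ^ 3 := by
      rw [e₈]
      refine (norm_sub_le_max_of_isUltrametricDist _ _).trans (max_le ?_ ?_)
      · refine (norm_sub_le_max_of_isUltrametricDist _ _).trans (max_le ?_ ?_)
        · refine (norm_sub_le_max_of_isUltrametricDist _ _).trans (max_le ?_ ?_)
          · exact (norm_sub_le_max_of_isUltrametricDist _ _).trans
              (max_le (hu8.trans hr3) (hb₈.trans hr3))
          · rw [norm_mul, norm_mul]
            calc ‖(3 : F)‖ * ‖r‖ * ‖W₁.b₆‖ ≤ 1 * ‖r‖ * 1 := by gcongr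
              _ = ‖r‖ ^ 1 := by ring
              _ ≤ ‖r‖ ^ 3 := pow_le_pow_right₀ hr1 (by norm_num)
        · rw [norm_mul, norm_mul, norm_pow]
          calc ‖(3 : F)‖ * ‖r‖ ^ 2 * ‖W₁.b₄‖ ≤ 1 * ‖r‖ ^ 2 * 1 := by gcongr
            _ = ‖r‖ ^ 2 := by ring
            _ ≤ ‖r‖ ^ 3 := pow_le_pow_right₀ hr1 (by norm_num)
      · rw [norm_mul, norm_pow]
        exact mul_le_of_le_one_right (pow_nonneg (norm_nonneg _) _) hb₂
    have h4 : ‖(4 : F) * r‖ ≤ 1 := by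
      have h : ‖(4 : F)‖ * ‖r‖ * ‖r‖ ^ 2 ≤ 1 * ‖r‖ ^ 2 := by
        calc ‖(4 : F)‖ * ‖r‖ * ‖r‖ ^ 2 = ‖(4 : F) * r ^ 3‖ := by rw [norm_mul, norm_pow]; ring
          _ ≤ ‖r‖ ^ 2 := key₄
          _ = 1 * ‖r‖ ^ 2 := (one_mul _).symm
      rw [norm_mul]
      exact le_of_mul_le_mul_right h (by positivity)
    have h3 : ‖(3 : F) * r‖ ≤ 1 := by
      have h : ‖(3 : F)‖ * ‖r‖ * ‖r‖ ^ 3 ≤ 1 * ‖r‖ ^ 3 := by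
        calc ‖(3 : F)‖ * ‖r‖ * ‖r‖ ^ 3 = ‖(3 : F) * r ^ 4‖ := by rw [norm_mul, norm_pow]; ring
          _ ≤ ‖r‖ ^ 3 := key₃
          _ = 1 * ‖r‖ ^ 3 := (one_mul _).symm
      rw [norm_mul]
      exact le_of_mul_le_mul_right h (by positivity)
    have : ‖r‖ ≤ 1 := by
      have e : r = 4 * r - 3 * r := by ring
      rw [e]
      exact (norm_sub_le_max_of_isUltrametricDist _ _).trans (max_le h4 h3)
    exact absurd this (not_le.mpr hcon)
  have hs : ‖s‖ ≤ 1 := by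
    by_contra hcon
    rw [not_le] at hcon
    have e₂ : s ^ 2 = W₁.a₂ - s * W₁.a₁ + 3 * r - u ^ 2 * W₂.a₂ := by
      have h := WeierstrassCurve.variableChange_a₂ W₁ C
      rw [hC] at h
      linear_combination u ^ 2 * h + (W₁.a₂ - s * W₁.a₁ + 3 * r - s ^ 2) * hinv 2
    have key : ‖s‖ ^ 2 ≤ ‖s‖ := by
      rw [← norm_pow, e₂]
      refine (norm_sub_le_max_of_isUltrametricDist _ _).trans (max_le ?_ ?_)
      · refine (IsUltrametricDist.norm_add_le_max _ _).trans (max_le ?_ ?_)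
        · refine (norm_sub_le_max_of_isUltrametricDist _ _).trans
            (max_le (h₁₂.trans hcon.le) ?_)
          rw [norm_mul]; exact mul_le_of_le_one_right (norm_nonneg _) h₁₁
        · exact (norm_mul_le_one h3F hr).trans hcon.le
      · exact (norm_mul_le_one (hupow 2) h₂₂).trans hcon.le
    nlinarith
  have ht : ‖t‖ ≤ 1 := by
    by_contra hcon
    rw [not_le] at hcon
    have e₆' : t ^ 2 = W₁.a₆ + r * W₁.a₄ + r ^ 2 * W₁.a₂ + r ^ 3 - t * W₁.a₃ - r * t * W₁.a₁
        - u ^ 6 * W₂.a₆ := by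
      have h := WeierstrassCurve.variableChange_a₆ W₁ C
      rw [hC] at h
      linear_combination u ^ 6 * h +
        (W₁.a₆ + r * W₁.a₄ + r ^ 2 * W₁.a₂ + r ^ 3 - t * W₁.a₃ - t ^ 2 - r * t * W₁.a₁) * hinv 6
    have hr2 : ‖r ^ 2‖ ≤ 1 := by rw [norm_pow]; exact pow_le_one₀ (norm_nonneg _) hr
    have hr3 : ‖r ^ 3‖ ≤ 1 := by rw [norm_pow]; exact pow_le_one₀ (norm_nonneg _) hr
    have key : ‖t‖ ^ 2 ≤ ‖t‖ := by
      rw [← norm_pow, e₆']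
      refine (norm_sub_le_max_of_isUltrametricDist _ _).trans (max_le ?_ ?_)
      · refine (norm_sub_le_max_of_isUltrametricDist _ _).trans (max_le ?_ ?_)
        · refine (norm_sub_le_max_of_isUltrametricDist _ _).trans (max_le ?_ ?_)
          · refine (IsUltrametricDist.norm_add_le_max _ _).trans (max_le ?_ (hr3.trans hcon.le))
            refine (IsUltrametricDist.norm_add_le_max _ _).trans (max_le ?_ ?_)
            · exact (norm_add_le_one h₁₆ (norm_mul_le_one hr h₁₄)).trans hcon.le
            · exact (norm_mul_le_one hr2 h₁₂).trans hcon.le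
          · rw [norm_mul]; exact mul_le_of_le_one_right (norm_nonneg _) h₁₃
        · rw [norm_mul, norm_mul]
          calc ‖r‖ * ‖t‖ * ‖W₁.a₁‖ ≤ 1 * ‖t‖ * 1 := by gcongr
            _ = ‖t‖ := by ring
      · exact (norm_mul_le_one (hupow 6) h₂₆).trans hcon.le
    nlinarith
  exact ⟨hr, hs, ht⟩

end Integrality


/-! ### Proportional invariants over a field of characteristic zero -/

section Proportional

variable {F : Type*} [Field F] [CharZero F]

omit [CharZero F] in
/-- The scaling `(x, y) ↦ (v²x, v³y)` of a short model. [cite: SilvermanAEC2009, §III.1 Table 3.1] -/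
theorem scale_smul_shortModel' (v : F) (hv : v ≠ 0) (a b : F) :
    (⟨(Units.mk0 v hv)⁻¹, 0, 0, 0⟩ : VariableChange F) • (⟨0, 0, 0, a, b⟩ : WeierstrassCurve F)
      = ⟨0, 0, 0, v ^ 4 * a, v ^ 6 * b⟩ := by
  rw [variableChange_def]
  simp only [inv_inv, Units.val_mk0]
  ext <;> ring

/-- **Curves with proportional invariants are isomorphic**, over any field of characteristic
zero (as the tree's `exists_variableChange_of_c₄_eq_of_c₆_eq` over `ℚ`): if
`c₄(W₂) = w⁻⁴ c₄(W₁)` and `c₆(W₂) = w⁻⁶ c₆(W₁)` with `w ≠ 0` then `C • W₁ = W₂` for some `C`.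
[cite: SilvermanAEC2009, §III.1 Table 3.1] -/
theorem exists_variableChange_of_c₄_eq_of_c₆_eq' {W₁ W₂ : WeierstrassCurve F} {w : F}
    (hw : w ≠ 0) (h₄ : W₂.c₄ = (w ^ 4)⁻¹ * W₁.c₄) (h₆ : W₂.c₆ = (w ^ 6)⁻¹ * W₁.c₆) :
    ∃ C : VariableChange F, C • W₁ = W₂ := by
  letI : Invertible (2 : F) := invertibleOfNonzero two_ne_zero
  letI : Invertible (3 : F) := invertibleOfNonzero three_ne_zero
  obtain ⟨C₁, ⟨h₁₁, h₁₂, h₁₃⟩⟩ := W₁.exists_variableChange_isShortNF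
  obtain ⟨a₁, b₁, hS₁⟩ : ∃ a b : F, C₁ • W₁ = ⟨0, 0, 0, a, b⟩ :=
    ⟨_, _, by ext; exacts [h₁₁, h₁₂, h₁₃, rfl, rfl]⟩
  obtain ⟨C₂, ⟨h₂₁, h₂₂, h₂₃⟩⟩ := W₂.exists_variableChange_isShortNF
  obtain ⟨a₂, b₂, hS₂⟩ : ∃ a b : F, C₂ • W₂ = ⟨0, 0, 0, a, b⟩ :=
    ⟨_, _, by ext; exacts [h₂₁, h₂₂, h₂₃, rfl, rfl]⟩
  have key₄ : ∀ a b : F, (⟨0, 0, 0, a, b⟩ : WeierstrassCurve F).c₄ = -48 * a := fun a b ↦ by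
    simp only [WeierstrassCurve.c₄, WeierstrassCurve.b₂, WeierstrassCurve.b₄]; ring
  have key₆ : ∀ a b : F, (⟨0, 0, 0, a, b⟩ : WeierstrassCurve F).c₆ = -864 * b := fun a b ↦ by
    simp only [WeierstrassCurve.c₆, WeierstrassCurve.b₂, WeierstrassCurve.b₄,
      WeierstrassCurve.b₆]; ring
  have e₄₁ : ((C₁.u : F))⁻¹ ^ 4 * W₁.c₄ = -48 * a₁ := by
    rw [← key₄ a₁ b₁, ← hS₁, variableChange_c₄, Units.val_inv_eq_inv_val]
  have e₆₁ : ((C₁.u : F))⁻¹ ^ 6 * W₁.c₆ = -864 * b₁ := by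
    rw [← key₆ a₁ b₁, ← hS₁, variableChange_c₆, Units.val_inv_eq_inv_val]
  have e₄₂ : ((C₂.u : F))⁻¹ ^ 4 * W₂.c₄ = -48 * a₂ := by
    rw [← key₄ a₂ b₂, ← hS₂, variableChange_c₄, Units.val_inv_eq_inv_val]
  have e₆₂ : ((C₂.u : F))⁻¹ ^ 6 * W₂.c₆ = -864 * b₂ := by
    rw [← key₆ a₂ b₂, ← hS₂, variableChange_c₆, Units.val_inv_eq_inv_val]
  have hu₁ : (C₁.u : F) ≠ 0 := C₁.u.ne_zero
  have hu₂ : (C₂.u : F) ≠ 0 := C₂.u.ne_zero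
  set v : F := (C₁.u : F) * ((C₂.u : F) * w)⁻¹ with hv_def
  have hv : v ≠ 0 := mul_ne_zero hu₁ (inv_ne_zero (mul_ne_zero hu₂ hw))
  have h48 : (48 : F) ≠ 0 := by norm_num
  have h864 : (864 : F) ≠ 0 := by norm_num
  have ha : v ^ 4 * a₁ = a₂ := by
    rw [h₄] at e₄₂
    rw [hv_def]
    field_simp
    field_simp at e₄₁ e₄₂
    linear_combination ((1 : F) / 48) * e₄₁ - ((1 : F) / 48) * e₄₂
  have hb : v ^ 6 * b₁ = b₂ := by
    rw [h₆] at e₆₂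
    rw [hv_def]
    field_simp
    field_simp at e₆₁ e₆₂
    linear_combination ((1 : F) / 864) * e₆₁ - ((1 : F) / 864) * e₆₂
  refine ⟨C₂⁻¹ * ⟨(Units.mk0 v hv)⁻¹, 0, 0, 0⟩ * C₁, ?_⟩
  rw [mul_smul, mul_smul, hS₁, scale_smul_shortModel' v hv a₁ b₁, ha, hb, ← hS₂, inv_smul_smul]

end Proportional

/-! ### The nodal twist of a potentially multiplicative additive curve -/

section PotMult

open scoped IntermediateField
open Literature.NumberTheory.GaloisRepresentations IsLocalRing
open Literature.NumberTheory.EllipticCurves.ModularForms Literature.NumberTheory.Automorphic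
open scoped MatrixGroups ModularForm
open CongruenceSubgroup

set_option maxHeartbeats 4000000 in
/-- **The nodal twist at a potentially multiplicative prime.** Let `W'/ℚ` be globally minimal,
`p` a prime with `‖j(W')‖_p > 1` and `‖c₄(W')‖_p = p⁻ⁿ`. Over `K = ℚ_p(√(−c₄/c₆))` (a field in
which `W'` becomes isomorphic to the integral model
`E_j : y² + xy = x³ − 36/(j − 1728)·x − 1/(j − 1728)` of the same `j`-invariant, whose reduction
is the split node `y² + xy = x³`), with ring of integers `O`, a uniformiser `π` (`‖π‖ᵉ = p⁻¹`):
there are `r, s, t ∈ O` and an `O`-curve `V'' = (w⁻¹, 0, 0, 0) • E_j`, `w ∈ O^×`, with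
`V'' ⊗ K = (πᵏ, r, s, t) • (W' ⊗ K)`, `4k = ne`, and a UNIT coefficient of `[p]_{V''}` in degree
`p` (its reduction `y² + w̄xy = x³` is the nodal cubic with slopes `−w̄, 0`:
`coeff_formalMul_prime_nodalCubicOfSlopes`). Integrality of `r, s, t`:
`norm_rst_le_one_of_variableChange_eq`. [cite: SilvermanAEC2009, Prop. III.1.4(c), VII.1.3(d), VII.5.5] -/
theorem exists_nodalTwist_of_one_lt_norm_j {p : ℕ} [hp : Fact p.Prime]
    (W' : WeierstrassCurve ℚ) [W'.IsElliptic] [W'.IsGloballyMinimal]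
    (hj : 1 < ‖((W'.j : ℚ) : ℚ_[p])‖) {n : ℕ} (hn : ‖((W'.c₄ : ℚ) : ℚ_[p])‖ = ((p : ℝ)⁻¹) ^ n) :
    ∃ (K : IntermediateField ℚ_[p] (PadicAlgCl p)) (_ : FiniteDimensional ℚ_[p] K) (πu : Kˣ)
      (e k : ℕ) (r s t : padicCoeffRing K) (V'' : WeierstrassCurve (padicCoeffRing K)),
      ‖((πu : K) : PadicAlgCl p)‖ ^ e = (p : ℝ)⁻¹ ∧ 0 < e ∧ 4 * k = n * e ∧
      V''.map (algebraMap (padicCoeffRing K) K) =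
        (⟨πu ^ k, (r : K), (s : K), (t : K)⟩ : VariableChange K) • W'.map (algebraMap ℚ K) ∧
      IsUnit (coeff p (V''.formalMul p)) := by
  classical
  have hp1R : (1 : ℝ) < p := by exact_mod_cast hp.out.one_lt
  have hp0R : (0 : ℝ) < p := by positivity
  /- Step 1: the invariants of `W'` over `ℚ`. -/
  set jQ : ℚ := W'.j with hjQ
  set J : ℚ := jQ - 1728 with hJ
  have hjΔ : jQ * W'.Δ = W'.c₄ ^ 3 := by
    rw [hjQ, WeierstrassCurve.j, ← WeierstrassCurve.coe_Δ', mul_assoc, mul_comm (W'.c₄ ^ 3),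
      ← mul_assoc, Units.inv_mul, one_mul]
  have hcr : 1728 * W'.Δ = W'.c₄ ^ 3 - W'.c₆ ^ 2 := W'.c_relation
  have hJΔ : J * W'.Δ = W'.c₆ ^ 2 := by rw [hJ]; linear_combination hjΔ - hcr
  have hΔ0 : W'.Δ ≠ 0 := W'.isUnit_Δ.ne_zero
  have hnorm1728 : ‖((1728 : ℚ) : ℚ_[p])‖ ≤ 1 := by
    have h := Padic.norm_int_le_one (p := p) 1728
    push_cast at h ⊢
    exact h
  have hj0 : jQ ≠ 0 := by
    intro h
    rw [h, Rat.cast_zero, norm_zero] at hj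
    exact absurd hj (by norm_num)
  have hnormJ : ‖((J : ℚ) : ℚ_[p])‖ = ‖((jQ : ℚ) : ℚ_[p])‖ := by
    rw [hJ, Rat.cast_sub]
    exact norm_eq_of_norm_sub_lt' (by rw [sub_sub_cancel_left, norm_neg]; exact hnorm1728.trans_lt hj)
  have hjpos : 0 < ‖((jQ : ℚ) : ℚ_[p])‖ := one_pos.trans hj
  have hJ0 : J ≠ 0 := by
    intro h
    have h1 : ‖((J : ℚ) : ℚ_[p])‖ = 0 := by rw [h, Rat.cast_zero, norm_zero]
    rw [hnormJ] at h1
    linarith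
  have hc₄0 : W'.c₄ ≠ 0 := by
    intro h
    apply hj0
    have h3 := hjΔ
    rw [h, zero_pow three_ne_zero] at h3
    exact (mul_eq_zero.mp h3).resolve_right hΔ0
  have hc₆0 : W'.c₆ ≠ 0 := by
    intro h
    apply hJ0
    have h2 := hJΔ
    rw [h, zero_pow two_ne_zero] at h2
    exact (mul_eq_zero.mp h2).resolve_right hΔ0
  /- Step 2: the integral model `E_j` and the scaling factor `δ = −c₄/c₆`. -/
  set Ej : WeierstrassCurve ℚ := ⟨1, 0, 0, -36 / J, -1 / J⟩ with hEj
  have hEc₄ : Ej.c₄ = jQ / J := by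
    rw [hEj, hJ]
    simp only [WeierstrassCurve.c₄, WeierstrassCurve.b₂, WeierstrassCurve.b₄]
    rw [hJ] at hJ0
    field_simp
    ring
  have hEc₆ : Ej.c₆ = -jQ / J := by
    rw [hEj, hJ]
    simp only [WeierstrassCurve.c₆, WeierstrassCurve.b₂, WeierstrassCurve.b₄, WeierstrassCurve.b₆]
    rw [hJ] at hJ0
    field_simp
    ring
  set δ : ℚ := -W'.c₄ / W'.c₆ with hδ
  have hδ0 : δ ≠ 0 := div_ne_zero (neg_ne_zero.mpr hc₄0) hc₆0
  have I1 : Ej.c₄ = δ ^ 2 * W'.c₄ := by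
    rw [hEc₄, hδ, div_eq_iff hJ0]
    field_simp
    linear_combination (-jQ) * hJΔ + J * hjΔ
  have key : jQ * W'.c₆ ^ 2 = W'.c₄ ^ 3 * J := by linear_combination (-jQ) * hJΔ + J * hjΔ
  have I2 : Ej.c₆ = δ ^ 3 * W'.c₆ := by
    rw [hEc₆, hδ, div_pow, Odd.neg_pow (by decide : Odd 3), div_mul_eq_mul_div,
      div_eq_div_iff hJ0 (pow_ne_zero 3 hc₆0)]
    linear_combination (-W'.c₆) * key
  /- Step 3: the field `K = ℚ_p(√δ)` and the comparison maps. -/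
  set φ : ℚ →+* ℚ_[p] := algebraMap ℚ ℚ_[p] with hφ
  obtain ⟨u₀, hu₀⟩ := IsAlgClosed.exists_pow_nat_eq (algebraMap ℚ_[p] (PadicAlgCl p) (δ : ℚ_[p])) two_pos
  set K : IntermediateField ℚ_[p] (PadicAlgCl p) := ℚ_[p]⟮u₀⟯ with hKdef
  have hu₀int : IsIntegral ℚ_[p] u₀ :=
    IsIntegral.of_pow two_pos (by rw [hu₀]; exact isIntegral_algebraMap)
  haveI hKfd : FiniteDimensional ℚ_[p] K := IntermediateField.adjoin.finiteDimensional hu₀int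
  set φK : ℚ_[p] →+* K := algebraMap ℚ_[p] K with hφK
  set φQ : ℚ →+* K := algebraMap ℚ K with hφQ
  have hcomp : φK.comp φ = φQ := RingHom.ext fun x ↦ by
    rw [eq_ratCast (φK.comp φ) x, eq_ratCast φQ x]
  have hφQ' : ∀ x : ℚ, φQ x = φK (x : ℚ_[p]) := fun x ↦ by
    rw [← hcomp, RingHom.comp_apply, hφ, eq_ratCast]
  have hnormQ : ∀ x : ℚ, ‖((φQ x : K) : PadicAlgCl p)‖ = ‖(x : ℚ_[p])‖ := fun x ↦ by
    rw [hφQ', hφK, IntermediateField.coe_algebraMap_apply, PadicAlgCl.norm_extends]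
  -- `u' = u₀ ∈ K`, `u'² = δ`
  set u' : K := ⟨u₀, IntermediateField.mem_adjoin_simple_self ℚ_[p] u₀⟩ with hu'
  have hu'2 : u' ^ 2 = φQ δ := by
    apply Subtype.ext
    rw [SubmonoidClass.coe_pow, hφQ', hφK, IntermediateField.coe_algebraMap_apply]
    exact hu₀
  have hu'0 : u' ≠ 0 := by
    intro h
    have h2 : φQ δ = 0 := by rw [← hu'2, h, zero_pow two_ne_zero]
    exact hδ0 ((map_eq_zero φQ).mp h2)
  /- Step 4: the change of variables `D • (W' ⊗ K) = E_j ⊗ K`; `‖u(D)‖⁴ = ‖c₄(W')‖_p`. -/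
  set W'K : WeierstrassCurve K := W'.map φQ with hW'K
  set EjK : WeierstrassCurve K := Ej.map φQ with hEjK
  have h₄ : EjK.c₄ = ((u'⁻¹) ^ 4)⁻¹ * W'K.c₄ := by
    rw [hEjK, hW'K, map_c₄, map_c₄, I1, map_mul, map_pow, inv_pow, inv_inv, ← hu'2, ← pow_mul]
  have h₆ : EjK.c₆ = ((u'⁻¹) ^ 6)⁻¹ * W'K.c₆ := by
    rw [hEjK, hW'K, map_c₆, map_c₆, I2, map_mul, map_pow, inv_pow, inv_inv, ← hu'2, ← pow_mul]
  obtain ⟨D, hD⟩ := exists_variableChange_of_c₄_eq_of_c₆_eq' (inv_ne_zero hu'0) h₄ h₆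
  set d : K := (D.u : K) with hd
  have hd0 : d ≠ 0 := D.u.ne_zero
  have hc₄d : W'K.c₄ = d ^ 4 * EjK.c₄ := by
    rw [← hD, variableChange_c₄, ← mul_assoc, ← mul_pow, hd, Units.mul_inv, one_pow, one_mul]
  have hnormEc₄ : ‖((EjK.c₄ : K) : PadicAlgCl p)‖ = 1 := by
    rw [hEjK, map_c₄, hEc₄, hnormQ, Rat.cast_div, norm_div, hnormJ, div_self hjpos.ne']
  have hnormd4 : ‖((d : K) : PadicAlgCl p)‖ ^ 4 = ((p : ℝ)⁻¹) ^ n := by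
    have h : ‖((W'K.c₄ : K) : PadicAlgCl p)‖ = ‖((d ^ 4 * EjK.c₄ : K) : PadicAlgCl p)‖ := by
      rw [hc₄d]
    rw [hW'K, map_c₄, hnormQ, hn] at h
    rw [h]
    push_cast
    rw [norm_mul, norm_pow, hnormEc₄, mul_one]
  have hdA0 : ((d : K) : PadicAlgCl p) ≠ 0 := fun h ↦ hd0 (by exact_mod_cast h)
  /- Step 5: `O = 𝒪_K`, a uniformiser `ϖ`, `p ~ ϖᵉ`, `d = w ϖᵏ`, `4k = ne`. -/
  letI hOloc : IsLocalRing (padicCoeffRing K) := isLocalRing_padicCoeffRing K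
  haveI hOdvr : IsDiscreteValuationRing (padicCoeffRing K) :=
    isDiscreteValuationRing_padicCoeffRing K
  letI hOch : CharP (ResidueField (padicCoeffRing K)) p := charP_residueField_padicCoeffRing K
  obtain ⟨ϖ, hϖ⟩ := IsDiscreteValuationRing.exists_irreducible (padicCoeffRing K)
  have hϖ0 : ((ϖ : padicCoeffRing K) : K) ≠ 0 := fun h ↦ hϖ.ne_zero (Subtype.ext h)
  have hϖA0 : (((ϖ : padicCoeffRing K) : K) : PadicAlgCl p) ≠ 0 := fun h ↦ hϖ0 (by exact_mod_cast h)
  have hϖlt : ‖(((ϖ : padicCoeffRing K) : K) : PadicAlgCl p)‖ < 1 :=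
    (mem_nonunits_padicCoeffRing_iff K ϖ).mp (mem_nonunits_iff.mpr hϖ.not_isUnit)
  have hϖpos : 0 < ‖(((ϖ : padicCoeffRing K) : K) : PadicAlgCl p)‖ := norm_pos_iff.mpr hϖA0
  have hpA : ‖((p : ℕ) : PadicAlgCl p)‖ = (p : ℝ)⁻¹ := by
    rw [← map_natCast (algebraMap ℚ_[p] (PadicAlgCl p)) p]
    change ‖((p : ℚ_[p]) : PadicAlgCl p)‖ = (p : ℝ)⁻¹
    rw [PadicAlgCl.norm_extends, Padic.norm_p]
  have hpO0 : ((p : ℕ) : padicCoeffRing K) ≠ 0 := by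
    intro h
    have h1 : ‖((((p : ℕ) : padicCoeffRing K) : K) : PadicAlgCl p)‖ = 0 := by rw [h]; simp
    push_cast at h1
    rw [hpA] at h1
    exact (inv_ne_zero hp0R.ne') h1
  obtain ⟨e, v, hpe⟩ := IsDiscreteValuationRing.eq_unit_mul_pow_irreducible hpO0 hϖ
  have hπe : ‖(((ϖ : padicCoeffRing K) : K) : PadicAlgCl p)‖ ^ e = (p : ℝ)⁻¹ := by
    have h : ‖((((p : ℕ) : padicCoeffRing K) : K) : PadicAlgCl p)‖ =
        ‖(((v * ϖ ^ e : padicCoeffRing K) : K) : PadicAlgCl p)‖ := by rw [hpe]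
    push_cast at h
    rw [norm_mul, norm_pow, (isUnit_padicCoeffRing_iff K _).mp v.isUnit, one_mul, hpA] at h
    exact h.symm
  have he0 : 0 < e := by
    rcases Nat.eq_zero_or_pos e with h | h
    · rw [h, pow_zero] at hπe
      exact absurd hπe (ne_of_gt (inv_lt_one_of_one_lt₀ hp1R))
    · exact h
  have hdle : ‖((d : K) : PadicAlgCl p)‖ ≤ 1 := by
    have h4 : ‖((d : K) : PadicAlgCl p)‖ ^ 4 ≤ 1 := by
      rw [hnormd4]; exact pow_le_one₀ (by positivity) (inv_le_one_of_one_le₀ hp1R.le)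
    exact (pow_le_one_iff_of_nonneg (norm_nonneg _) four_ne_zero).mp h4
  set dO : padicCoeffRing K := ⟨d, (mem_padicCoeffRing_iff K d).mpr hdle⟩ with hdO
  have hdO0 : dO ≠ 0 := fun h ↦ hd0 (congrArg Subtype.val h)
  obtain ⟨k, w, hdk⟩ := IsDiscreteValuationRing.eq_unit_mul_pow_irreducible hdO0 hϖ
  have hw0K : ((w : padicCoeffRing K) : K) ≠ 0 := fun h ↦
    (w.isUnit.ne_zero) (Subtype.ext h)
  have hdK : d = ((w : padicCoeffRing K) : K) * ((ϖ : padicCoeffRing K) : K) ^ k := by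
    have h : ((dO : padicCoeffRing K) : K) = (((w * ϖ ^ k : padicCoeffRing K)) : K) := by rw [hdk]
    push_cast at h
    exact h
  have hke : 4 * k = n * e := by
    have h : ‖((d : K) : PadicAlgCl p)‖ ^ 4 =
        ‖((((w : padicCoeffRing K) : K) * ((ϖ : padicCoeffRing K) : K) ^ k : K) : PadicAlgCl p)‖ ^ 4 := by
      rw [← hdK]
    push_cast at h
    rw [norm_mul, norm_pow, (isUnit_padicCoeffRing_iff K _).mp w.isUnit, one_mul, ← pow_mul] at h
    rw [hnormd4, ← hπe, ← pow_mul] at h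
    have h' := pow_right_injective₀ hϖpos hϖlt.ne h
    linarith
  /- Step 6: `r, s, t ∈ O` (Silverman VII.1.3(d), read in `ℚ̄_p`). -/
  set jA : K →+* PadicAlgCl p := algebraMap K (PadicAlgCl p) with hjA
  have hjA' : ∀ x : K, jA x = (x : PadicAlgCl p) := fun x ↦ rfl
  have hiW := map_integralModelInt W'
  have hintW : ∀ x : ℤ, ‖((φQ (x : ℚ) : K) : PadicAlgCl p)‖ ≤ 1 := fun x ↦ by
    rw [hnormQ, Rat.cast_intCast]; exact Padic.norm_int_le_one x
  have ha₁ : W'.a₁ = ((integralModelInt W').a₁ : ℚ) := by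
    have h := congrArg WeierstrassCurve.a₁ hiW
    simp only [WeierstrassCurve.map, eq_intCast] at h
    exact h.symm
  have ha₂ : W'.a₂ = ((integralModelInt W').a₂ : ℚ) := by
    have h := congrArg WeierstrassCurve.a₂ hiW
    simp only [WeierstrassCurve.map, eq_intCast] at h
    exact h.symm
  have ha₃ : W'.a₃ = ((integralModelInt W').a₃ : ℚ) := by
    have h := congrArg WeierstrassCurve.a₃ hiW
    simp only [WeierstrassCurve.map, eq_intCast] at h
    exact h.symm
  have ha₄ : W'.a₄ = ((integralModelInt W').a₄ : ℚ) := by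
    have h := congrArg WeierstrassCurve.a₄ hiW
    simp only [WeierstrassCurve.map, eq_intCast] at h
    exact h.symm
  have ha₆ : W'.a₆ = ((integralModelInt W').a₆ : ℚ) := by
    have h := congrArg WeierstrassCurve.a₆ hiW
    simp only [WeierstrassCurve.map, eq_intCast] at h
    exact h.symm
  have hnorm36 : ‖((36 : ℚ) : ℚ_[p])‖ ≤ 1 := by
    have h := Padic.norm_int_le_one (p := p) 36
    push_cast at h ⊢
    exact h
  have ha₄n : ‖((-36 / J : ℚ) : ℚ_[p])‖ < 1 := by
    rw [Rat.cast_div, Rat.cast_neg, norm_div, norm_neg, hnormJ]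
    calc ‖((36 : ℚ) : ℚ_[p])‖ / ‖((jQ : ℚ) : ℚ_[p])‖ ≤ 1 / ‖((jQ : ℚ) : ℚ_[p])‖ := by gcongr
      _ < 1 := (div_lt_one hjpos).mpr hj
  have ha₆n : ‖((-1 / J : ℚ) : ℚ_[p])‖ < 1 := by
    rw [Rat.cast_div, Rat.cast_neg, norm_div, norm_neg, hnormJ, Rat.cast_one, norm_one]
    exact (div_lt_one hjpos).mpr hj
  have hDA : (D.map jA) • (W'K.map jA) = EjK.map jA := by rw [map_variableChange, hD]
  obtain ⟨hr, hs, ht⟩ := norm_rst_le_one_of_variableChange_eq (F := PadicAlgCl p) hDA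
    (by change ‖jA d‖ ≤ 1; rw [hjA']; exact hdle)
    ⟨by change ‖jA (φQ W'.a₁)‖ ≤ 1; rw [hjA', ha₁]; exact hintW _,
     by change ‖jA (φQ W'.a₂)‖ ≤ 1; rw [hjA', ha₂]; exact hintW _,
     by change ‖jA (φQ W'.a₃)‖ ≤ 1; rw [hjA', ha₃]; exact hintW _,
     by change ‖jA (φQ W'.a₄)‖ ≤ 1; rw [hjA', ha₄]; exact hintW _,
     by change ‖jA (φQ W'.a₆)‖ ≤ 1; rw [hjA', ha₆]; exact hintW _⟩
    ⟨by change ‖jA (φQ 1)‖ ≤ 1; rw [map_one, map_one, norm_one],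
     by change ‖jA (φQ 0)‖ ≤ 1; rw [map_zero, map_zero, norm_zero]; exact zero_le_one,
     by change ‖jA (φQ 0)‖ ≤ 1; rw [map_zero, map_zero, norm_zero]; exact zero_le_one,
     by change ‖jA (φQ (-36 / J))‖ ≤ 1; rw [hjA', hnormQ]; exact ha₄n.le,
     by change ‖jA (φQ (-1 / J))‖ ≤ 1; rw [hjA', hnormQ]; exact ha₆n.le⟩
  change ‖((D.r : K) : PadicAlgCl p)‖ ≤ 1 at hr
  change ‖((D.s : K) : PadicAlgCl p)‖ ≤ 1 at hs
  change ‖((D.t : K) : PadicAlgCl p)‖ ≤ 1 at ht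
  set rO : padicCoeffRing K := ⟨D.r, (mem_padicCoeffRing_iff K _).mpr hr⟩ with hrO
  set sO : padicCoeffRing K := ⟨D.s, (mem_padicCoeffRing_iff K _).mpr hs⟩ with hsO
  set tO : padicCoeffRing K := ⟨D.t, (mem_padicCoeffRing_iff K _).mpr ht⟩ with htO
  /- Step 7: the `O`-curve `V'' = (w⁻¹, 0, 0, 0) • E_j` and its comparison with `W' ⊗ K`. -/
  have hA₄ : ‖((φQ (-36 / J) : K) : PadicAlgCl p)‖ ≤ 1 := by rw [hnormQ]; exact ha₄n.le
  have hA₆ : ‖((φQ (-1 / J) : K) : PadicAlgCl p)‖ ≤ 1 := by rw [hnormQ]; exact ha₆n.le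
  set A₄ : padicCoeffRing K := ⟨φQ (-36 / J), (mem_padicCoeffRing_iff K _).mpr hA₄⟩ with hA₄def
  set A₆ : padicCoeffRing K := ⟨φQ (-1 / J), (mem_padicCoeffRing_iff K _).mpr hA₆⟩ with hA₆def
  set wO : padicCoeffRing K := (w : padicCoeffRing K) with hwO
  set V'' : WeierstrassCurve (padicCoeffRing K) := ⟨wO, 0, 0, wO ^ 4 * A₄, wO ^ 6 * A₆⟩ with hV''
  set πu : Kˣ := Units.mk0 ((ϖ : padicCoeffRing K) : K) hϖ0 with hπu
  set wK : Kˣ := Units.mk0 ((w : padicCoeffRing K) : K) hw0K with hwK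
  have hVar : (⟨πu ^ k, (rO : K), (sO : K), (tO : K)⟩ : VariableChange K) = ⟨wK⁻¹, 0, 0, 0⟩ * D := by
    rw [VariableChange.mul_def]
    congr 1
    · apply Units.ext
      rw [Units.val_pow_eq_pow_val, Units.val_mul, Units.val_inv_eq_inv_val, hπu, hwK, Units.val_mk0,
        Units.val_mk0, ← hd, hdK, ← mul_assoc, inv_mul_cancel₀ hw0K, one_mul]
    · simp [hrO]
    · simp [hsO]
    · simp [htO]
  have halgO : ∀ y : padicCoeffRing K, algebraMap (padicCoeffRing K) K y = (y : K) := fun y ↦ rfl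
  have hA₄K : (A₄ : K) = φQ (-36 / J) := rfl
  have hA₆K : (A₆ : K) = φQ (-1 / J) := rfl
  have hV''K : V''.map (algebraMap (padicCoeffRing K) K) =
      (⟨πu ^ k, (rO : K), (sO : K), (tO : K)⟩ : VariableChange K) • W'K := by
    rw [hVar, mul_smul, hD]
    ext
    · simp only [hV'', WeierstrassCurve.map, halgO, hEjK, hEj, variableChange_a₁, hwK, inv_inv,
        Units.val_mk0, map_one, mul_zero, add_zero, mul_one, hwO]
    · simp only [hV'', WeierstrassCurve.map, halgO, hEjK, hEj, variableChange_a₂, hwK, inv_inv,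
        Units.val_mk0, map_one, map_zero, mul_zero, add_zero, sub_zero, mul_one, hwO]
      push_cast; ring
    · simp only [hV'', WeierstrassCurve.map, halgO, hEjK, hEj, variableChange_a₃, hwK, inv_inv,
        Units.val_mk0, map_one, map_zero, mul_zero, add_zero, mul_one, hwO]
      push_cast; ring
    · simp only [hV'', WeierstrassCurve.map, halgO, hEjK, hEj, variableChange_a₄, hwK, inv_inv,
        Units.val_mk0, map_one, map_zero, mul_zero, add_zero, sub_zero, mul_one, hwO]
      push_cast
      rw [hA₄K]; ring
    · simp only [hV'', WeierstrassCurve.map, halgO, hEjK, hEj, variableChange_a₆, hwK, inv_inv,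
        Units.val_mk0, map_one, map_zero, mul_zero, add_zero, sub_zero, zero_mul, mul_one, hwO]
      push_cast
      rw [hA₆K]; ring
  /- Step 8: the reduction of `V''` is the nodal cubic `T(−w̄, 0)`: unit coefficient at `zᵖ`. -/
  have hA₄res : residue (padicCoeffRing K) A₄ = 0 :=
    (residue_eq_zero_iff _).mpr ((mem_maximalIdeal_padicCoeffRing_iff K _).mpr (by rw [hnormQ]; exact ha₄n))
  have hA₆res : residue (padicCoeffRing K) A₆ = 0 :=
    (residue_eq_zero_iff _).mpr ((mem_maximalIdeal_padicCoeffRing_iff K _).mpr (by rw [hnormQ]; exact ha₆n))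
  have hVres : V''.map (residue (padicCoeffRing K)) =
      nodalCubicOfSlopes (-(residue (padicCoeffRing K) wO)) 0 := by
    rw [hV'']
    ext
    · simp [WeierstrassCurve.map]
    · simp [WeierstrassCurve.map]
    · simp [WeierstrassCurve.map]
    · simp [WeierstrassCurve.map, hA₄res]
    · simp [WeierstrassCurve.map, hA₆res]
  have hwres : residue (padicCoeffRing K) wO ≠ 0 := (residue_ne_zero_iff_isUnit _).mpr w.isUnit
  have hcoef := (coeff_formalMul_prime_nodalCubicOfSlopes (k := ResidueField (padicCoeffRing K))
    (-(residue (padicCoeffRing K) wO)) 0 (by rwa [ne_eq, neg_eq_zero])).2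
  have hunit : IsUnit (coeff p (V''.formalMul p)) := by
    rw [← residue_ne_zero_iff_isUnit, ← coeff_map, map_formalMul, hVres, hcoef, sub_zero]
    exact pow_ne_zero _ (neg_ne_zero.mpr hwres)
  refine ⟨K, hKfd, πu, e, k, rO, sO, tO, V'', ?_, he0, hke, hV''K, hunit⟩
  rw [hπu, Units.val_mk0]
  exact hπe

/-- **`‖q‖_p ≤ 1` at a potentially multiplicative additive prime.** For the data of the fact
`edixhoven_int_of_neronLattice_eq_smul_periodLattice`, a prime `p ∣ Δ_min(W')`, `p ∣ c₄(W')`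
(additive reduction) with `‖j(W')‖_p > 1` (potentially multiplicative: type `Iₙ*`, `n ≥ 1`, at
odd `p`; the `v(j) < 0` twists at `2`) and `‖c₄(W')‖_p = p⁻ⁿ` with `(p − 1)n < 4p` — i.e.
`n < 8` at `2`, `n < 6` at `3` (always, by the Kraus bounds of `KrausNonMinimalityTwoThreeProofs`),
`n ≤ 4` at `p ≥ 5` —: `‖q‖_p ≤ 1`. Proof: the nodal twist `exists_nodalTwist_of_one_lt_norm_j`
(`J = p`, `4k = ne`) fed to `…_of_semistableTwist_sharp`. [cite: EdixhovenManin1991, Prop. 2]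
[cite: SilvermanAEC2009, Prop. III.1.4(c), VII.5.5] -/
theorem padicNorm_le_one_of_neronLattice_eq_smul_periodLattice_of_one_lt_norm_j
    {N : ℕ} [NeZero N]
    {W' : WeierstrassCurve ℚ} [W'.IsElliptic] [W'.IsGloballyMinimal] {f : CuspForm (Gamma0 N) 2}
    {L' : PeriodPair} (hf : IsNewformOf W' f) (hL' : IsNeronLatticeOf (W'.baseChange ℂ) L')
    {q : ℚ} (hq : ∀ z ∈ periodLattice f, (q : ℂ) * z ∈ L'.lattice)
    (hq' : ∀ z ∈ L'.lattice, ∃ w ∈ periodLattice f, z = q * w)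
    {p : ℕ} [hp : Fact p.Prime] (hΔ : (p : ℤ) ∣ minimalDiscriminantInt W')
    (hc₄ : (p : ℤ) ∣ (integralModelInt W').c₄) (hj : 1 < ‖((W'.j : ℚ) : ℚ_[p])‖) {n : ℕ}
    (hn : ‖((W'.c₄ : ℚ) : ℚ_[p])‖ = ((p : ℝ)⁻¹) ^ n) (hnp : (p - 1) * n < 4 * p) :
    ‖(q : ℚ_[p])‖ ≤ 1 := by
  obtain ⟨K, hK, πu, e, k, r, s, t, V'', hπe, he, hke, hV'', hunit⟩ :=
    exists_nodalTwist_of_one_lt_norm_j W' hj hn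
  haveI := hK
  refine padicNorm_le_one_of_neronLattice_eq_smul_periodLattice_of_semistableTwist_sharp hf hL' hq
    hq' hΔ hc₄ K πu hπe r s t V'' hV'' ⟨p, hp.out.pos, hunit, ?_⟩
  -- `(p − 1)k < pe` from `4k = ne` and `(p − 1)n < 4p`
  have h4 : 4 * ((p - 1) * k) < 4 * (p * e) := by
    calc 4 * ((p - 1) * k) = (p - 1) * (4 * k) := by ring
      _ = (p - 1) * n * e := by rw [hke]; ring
      _ < 4 * p * e := Nat.mul_lt_mul_of_pos_right hnp he
      _ = 4 * (p * e) := by ring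
  exact Nat.lt_of_mul_lt_mul_left h4

/-- `c₄(W') = c₄(W'_ℤ)` in `ℚ`. [folklore] -/
theorem c₄_eq_intCast_c₄_integralModelInt (W' : WeierstrassCurve ℚ) [W'.IsGloballyMinimal] :
    W'.c₄ = ((integralModelInt W').c₄ : ℚ) := by
  have h := (integralModelInt W').map_c₄ (Int.castRingHom ℚ)
  rw [map_integralModelInt, eq_intCast] at h
  exact h

/-- `‖c₄(W')‖_p = p^{−v_p(c₄)}` when `c₄ ≠ 0`. [folklore] -/
theorem norm_c₄_eq_inv_pow_padicValInt (W' : WeierstrassCurve ℚ) [W'.IsGloballyMinimal] {p : ℕ}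
    [hp : Fact p.Prime] (hc₄0 : (integralModelInt W').c₄ ≠ 0) :
    ‖((W'.c₄ : ℚ) : ℚ_[p])‖ = ((p : ℝ)⁻¹) ^ padicValInt p (integralModelInt W').c₄ := by
  rw [c₄_eq_intCast_c₄_integralModelInt, Padic.eq_padicNorm,
    padicNorm.eq_zpow_of_nonzero (by exact_mod_cast hc₄0), padicValRat.of_int, zpow_neg,
    zpow_natCast, inv_pow]
  push_cast
  rfl

/-- **`v_p(Δ_min) > 3 v_p(c₄)` when `‖j‖_p > 1`:** `‖Δ_min‖_p < ‖c₄‖_p³` (from `jΔ = c₄³`).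
[cite: SilvermanAEC2009, Prop. VII.5.5] -/
theorem norm_minimalDiscriminantInt_lt_of_one_lt_norm_j (W' : WeierstrassCurve ℚ) [W'.IsElliptic]
    [W'.IsGloballyMinimal] {p : ℕ} [hp : Fact p.Prime] (hj : 1 < ‖((W'.j : ℚ) : ℚ_[p])‖) :
    ‖((minimalDiscriminantInt W' : ℚ) : ℚ_[p])‖ < ‖((W'.c₄ : ℚ) : ℚ_[p])‖ ^ 3 := by
  have hjΔ : W'.j * W'.Δ = W'.c₄ ^ 3 := by
    rw [WeierstrassCurve.j, ← WeierstrassCurve.coe_Δ', mul_assoc, mul_comm (W'.c₄ ^ 3),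
      ← mul_assoc, Units.inv_mul, one_mul]
  have hΔ0 : ((minimalDiscriminantInt W' : ℚ) : ℚ_[p]) ≠ 0 := by
    rw [cast_minimalDiscriminantInt]; exact_mod_cast W'.isUnit_Δ.ne_zero
  have h : ((W'.j : ℚ) : ℚ_[p]) * ((minimalDiscriminantInt W' : ℚ) : ℚ_[p]) =
      ((W'.c₄ : ℚ) : ℚ_[p]) ^ 3 := by
    rw [cast_minimalDiscriminantInt]; exact_mod_cast hjΔ
  rw [← norm_pow, ← h, norm_mul]
  exact lt_mul_of_one_lt_left (norm_pos_iff.mpr hΔ0) hj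

/-- **`‖q‖₂ ≤ 1` at a potentially multiplicative additive prime `2`** (`v₂(j) < 0`): the bound
`v₂(c₄) < 8` needed by `…_of_one_lt_norm_j` is automatic — `v₂(c₄) ≥ 8` would force
`v₂(Δ_min) > 24 ≥ 16`, against Kraus (`not_pow_dvd_c₄_minimalDiscriminantInt_two`).
[cite: EdixhovenManin1991, Prop. 2] [cite: SilvermanAEC2009, Prop. VII.5.5, Ex. 7.1] -/
theorem padicNorm_le_one_of_neronLattice_eq_smul_periodLattice_of_one_lt_norm_j_two
    {N : ℕ} [NeZero N]
    {W' : WeierstrassCurve ℚ} [W'.IsElliptic] [W'.IsGloballyMinimal] {f : CuspForm (Gamma0 N) 2}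
    {L' : PeriodPair} (hf : IsNewformOf W' f) (hL' : IsNeronLatticeOf (W'.baseChange ℂ) L')
    {q : ℚ} (hq : ∀ z ∈ periodLattice f, (q : ℂ) * z ∈ L'.lattice)
    (hq' : ∀ z ∈ L'.lattice, ∃ w ∈ periodLattice f, z = q * w)
    (hΔ : (2 : ℤ) ∣ minimalDiscriminantInt W') (hc₄ : (2 : ℤ) ∣ (integralModelInt W').c₄)
    (hj : 1 < ‖((W'.j : ℚ) : ℚ_[2])‖) : ‖(q : ℚ_[2])‖ ≤ 1 := by
  have hc₄0 : (integralModelInt W').c₄ ≠ 0 := by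
    intro h0
    have h := norm_minimalDiscriminantInt_lt_of_one_lt_norm_j W' (p := 2) hj
    rw [c₄_eq_intCast_c₄_integralModelInt, h0] at h
    simp only [Int.cast_zero, Rat.cast_zero, norm_zero, ne_eq, OfNat.ofNat_ne_zero,
      not_false_eq_true, zero_pow] at h
    exact absurd h (not_lt.mpr (norm_nonneg _))
  set n := padicValInt 2 (integralModelInt W').c₄ with hn_def
  have hn := norm_c₄_eq_inv_pow_padicValInt W' (p := 2) hc₄0
  refine padicNorm_le_one_of_neronLattice_eq_smul_periodLattice_of_one_lt_norm_j hf hL' hq hq'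
    (p := 2) (by exact_mod_cast hΔ) (by exact_mod_cast hc₄) hj hn ?_
  -- `n < 8`
  by_contra hcon
  have hn8 : 8 ≤ n := by omega
  apply not_pow_dvd_c₄_minimalDiscriminantInt_two W'
  refine ⟨(padicValInt_dvd_iff 8 _).mpr (Or.inr hn8), ?_⟩
  have hlt := norm_minimalDiscriminantInt_lt_of_one_lt_norm_j W' (p := 2) hj
  rw [hn, ← pow_mul] at hlt
  have hle : ‖((minimalDiscriminantInt W' : ℤ) : ℚ_[2])‖ ≤ ((2 : ℕ) : ℝ) ^ (-(16 : ℕ) : ℤ) := by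
    rw [zpow_neg, zpow_natCast, ← inv_pow]
    have h' : ‖((minimalDiscriminantInt W' : ℚ) : ℚ_[2])‖ =
        ‖((minimalDiscriminantInt W' : ℤ) : ℚ_[2])‖ := by push_cast; rfl
    rw [← h']
    refine hlt.le.trans (pow_le_pow_of_le_one (by positivity) ?_ (by omega))
    exact inv_le_one_of_one_le₀ (by norm_num)
  exact_mod_cast (Padic.norm_int_le_pow_iff_dvd _ 16).mp hle

/-- **`‖q‖₃ ≤ 1` at a potentially multiplicative additive prime `3`** (type `Iₙ*`, `n ≥ 1`):
`v₃(c₄) ≥ 6` would force `v₃(Δ_min) > 18 ≥ 14`, against Kraus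
(`not_pow_dvd_c₄_minimalDiscriminantInt_three`), so `2·v₃(c₄) < 12`.
[cite: EdixhovenManin1991, Prop. 2] [cite: SilvermanAEC2009, Prop. VII.5.5, Ex. 7.1] -/
theorem padicNorm_le_one_of_neronLattice_eq_smul_periodLattice_of_one_lt_norm_j_three
    {N : ℕ} [NeZero N]
    {W' : WeierstrassCurve ℚ} [W'.IsElliptic] [W'.IsGloballyMinimal] {f : CuspForm (Gamma0 N) 2}
    {L' : PeriodPair} (hf : IsNewformOf W' f) (hL' : IsNeronLatticeOf (W'.baseChange ℂ) L')
    {q : ℚ} (hq : ∀ z ∈ periodLattice f, (q : ℂ) * z ∈ L'.lattice)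
    (hq' : ∀ z ∈ L'.lattice, ∃ w ∈ periodLattice f, z = q * w)
    (hΔ : (3 : ℤ) ∣ minimalDiscriminantInt W') (hc₄ : (3 : ℤ) ∣ (integralModelInt W').c₄)
    (hj : 1 < ‖((W'.j : ℚ) : ℚ_[3])‖) : ‖(q : ℚ_[3])‖ ≤ 1 := by
  have hc₄0 : (integralModelInt W').c₄ ≠ 0 := by
    intro h0
    have h := norm_minimalDiscriminantInt_lt_of_one_lt_norm_j W' (p := 3) hj
    rw [c₄_eq_intCast_c₄_integralModelInt, h0] at h
    simp only [Int.cast_zero, Rat.cast_zero, norm_zero, ne_eq, OfNat.ofNat_ne_zero,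
      not_false_eq_true, zero_pow] at h
    exact absurd h (not_lt.mpr (norm_nonneg _))
  set n := padicValInt 3 (integralModelInt W').c₄ with hn_def
  have hn := norm_c₄_eq_inv_pow_padicValInt W' (p := 3) hc₄0
  refine padicNorm_le_one_of_neronLattice_eq_smul_periodLattice_of_one_lt_norm_j hf hL' hq hq'
    (p := 3) (by exact_mod_cast hΔ) (by exact_mod_cast hc₄) hj hn ?_
  -- `2n < 12`
  by_contra hcon
  have hn6 : 6 ≤ n := by omega
  apply not_pow_dvd_c₄_minimalDiscriminantInt_three W'
  refine ⟨(padicValInt_dvd_iff 5 _).mpr (Or.inr ((by norm_num : (5 : ℕ) ≤ 6).trans hn6)), ?_⟩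
  have hlt := norm_minimalDiscriminantInt_lt_of_one_lt_norm_j W' (p := 3) hj
  rw [hn, ← pow_mul] at hlt
  have hle : ‖((minimalDiscriminantInt W' : ℤ) : ℚ_[3])‖ ≤ ((3 : ℕ) : ℝ) ^ (-(14 : ℕ) : ℤ) := by
    rw [zpow_neg, zpow_natCast, ← inv_pow]
    have h' : ‖((minimalDiscriminantInt W' : ℚ) : ℚ_[3])‖ =
        ‖((minimalDiscriminantInt W' : ℤ) : ℚ_[3])‖ := by push_cast; rfl
    rw [← h']
    refine hlt.le.trans (pow_le_pow_of_le_one (by positivity) ?_ (by omega))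
    exact inv_le_one_of_one_le₀ (by norm_num)
  exact_mod_cast (Padic.norm_int_le_pow_iff_dvd _ 14).mp hle

end PotMult

end Literature.NumberTheory.EllipticCurves
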